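import Literature.NumberTheory.EllipticCurves.MuThreeTorsorClass
import Literature.NumberTheory.EllipticCurves.CPMuDescentGFunction
import Literature.NumberTheory.EllipticCurves.MordellCurveThreeDescentLocal
import Literature.NumberTheory.EllipticCurves.ThreeIsogenyKernelX
import HarnessLib

/-!
# Cohen–Pazuki's curves `y² = x³ − 3(ax + b)²`: the `μ₃`-kernel datum `T = (0, b√−3)`, the Vélu pair
# over `K̄` and over the completions, and the isogenous curve `Y² = X³ + (3aX/t + (4a³ + 9b)/t³)²`

Topic `NumberTheory/EllipticCurves`. Set-up file of the `3`-isogeny descent with kernel `μ₃` for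
Cohen–Pazuki's curves [CohenPazuki2009, §1.2 and Definition 1.3]

  `E : y² = x³ + D(ax + b)²`, `D = −3`: `cpCurve a b = [0, −3a², 0, −6ab, −3b²]`,

with kernel point `T = (0, b√D) = (0, b√−3)` («`T` is rational if and only if `D ∈ ℚ*²`»), Vélu
quotient `kernelXThreeCodomain (−3a²) (−6ab) (−3b²)` (tree, `ThreeIsogenyKernelX`) and Cohen–Pazuki's
model of the isogenous curve `Ê : Y² = X³ + D̂(âX + b̂)²`, `D̂ = −3D = 9`, `b̂ = (27b − 4a³D)/9`, read
here — after the scaling `(X, Y) ↦ (X/t², Y/t³)` by a unit `t` (their «the `x`-coordinate must be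
divided by `9` and the `y`-coordinate by `27`» is `t = 3`) — as the tree's
`threeTorsionModel m₂ s₂` with `t m₂ = 3a`, `t³ s₂ = 4a³ + 9b` (`variableChange_codomain`).
This generalises the tree's Mordell data (`MordellCurveThreeDescent`: `a = 0`, `b = c`,
`cpCurve 0 c = mordellCurve (−3c²)`) to `a ≠ 0`, i.e. to `j ≠ 0`. Contents:

* `cpCurve a b`, `map_cpCurve`, `Δ_cpCurve = −432 b³ (4a³ + 9b)`, `isElliptic_cpCurve`,
  `threeTorsionModel_eq_cpCurve` (`threeTorsionModel (aθ) (bθ) = cpCurve a b` when `θ² = −3`),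
  `threeIsogenyCodomain_eq`, `variableChange_codomain`.
* `isVeluThreePair_of_sq` — over any `K`-algebra field `L ∋ θ` with `θ² = −3`, the base change is the
  tree's Vélu pair `IsVeluThreePair (aθ) (bθ)`; instances `isVeluThreePair_geom` (`L = K̄`,
  `θ = MordellDescent.theta K`) and `isVeluThreePair_local` (`L = Ē`, `θ = thetaE K E`).
* **`CPMuDescent.kernelDatum`**: the `μ₃`-kernel datum (`MuThreeKernel`, file `MuThreeTorsorClass`)
  `T = (0, b·√−3) ∈ E(K̄)`, `σT = ε(σ)T` — hence the torsor classes `[C_u] ∈ H¹(K, E)`, `u ∈ K*`, of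
  Cohen–Pazuki's `μ₃`-descent (their `α̂`-side; for the Mordell case, Cassels' map `ℚ* → WC`).
* local transport (template `MordellCurveThreeDescentLocal`): `pointsMap_torsT`,
  `pointsMap_nsmul_torsT`, `pointsMap_torsorCocycle` — the restricted cocycle at a `K`-field `E` is
  `τ ↦ n(τ) T_E`, `n(τ) = kummerExp u (τ|_K̄)`.

What is NOT here: the kernel theorem / local conditions (sequel `CPMuDescentLocal`), anything global.

## References

* [CohenPazuki2009] H. Cohen, F. Pazuki, *Elementary 3-descent with a 3-isogeny*, Acta Arith. 140
  (2009) 369–404, §1.2, Definition 1.3, Proposition 1.4.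
* [SilvermanAEC2009] J. H. Silverman, *The Arithmetic of Elliptic Curves*, 2nd ed., X.§4.
* Templates in the tree: `MordellCurveThreeDescent` (`isVeluThreePair_mordell`, `torsT`),
  `MordellCurveThreeDescentLocal` (`isVeluThreePair_local`, `pointsMap_torsT`).
-/

noncomputable section

open scoped Classical

open WeierstrassCurve

universe u v

namespace Literature.NumberTheory.EllipticCurves

namespace CPMuDescent

open MordellDescent

/-! ## The model -/

section Model

variable {R : Type u} [CommRing R] {S : Type v} [CommRing S]

/-- **Cohen–Pazuki's curve `y² = x³ − 3(ax + b)²`** (`y² = x³ + D(ax + b)²` with `D = −3`):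
`[0, −3a², 0, −6ab, −3b²]`. [cite: CohenPazuki2009, §1.2] -/
def cpCurve (a b : R) : WeierstrassCurve R :=
  ⟨0, -3 * a ^ 2, 0, -6 * a * b, -3 * b ^ 2⟩

/-- `a₁ = 0`. [cite: CohenPazuki2009, §1.2] -/
@[simp] theorem cpCurve_a₁ (a b : R) : (cpCurve a b).a₁ = 0 := rfl
/-- `a₂ = −3a²`. [cite: CohenPazuki2009, §1.2] -/
@[simp] theorem cpCurve_a₂ (a b : R) : (cpCurve a b).a₂ = -3 * a ^ 2 := rfl
/-- `a₃ = 0`. [cite: CohenPazuki2009, §1.2] -/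
@[simp] theorem cpCurve_a₃ (a b : R) : (cpCurve a b).a₃ = 0 := rfl
/-- `a₄ = −6ab`. [cite: CohenPazuki2009, §1.2] -/
@[simp] theorem cpCurve_a₄ (a b : R) : (cpCurve a b).a₄ = -6 * a * b := rfl
/-- `a₆ = −3b²`. [cite: CohenPazuki2009, §1.2] -/
@[simp] theorem cpCurve_a₆ (a b : R) : (cpCurve a b).a₆ = -3 * b ^ 2 := rfl

/-- `cpCurve` is compatible with ring homomorphisms. [cite: CohenPazuki2009, §1.2] -/
theorem map_cpCurve (f : R →+* S) (a b : R) : (cpCurve a b).map f = cpCurve (f a) (f b) := by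
  simp only [cpCurve, WeierstrassCurve.map, map_neg, map_mul, map_pow, map_ofNat, map_zero]

/-- Base change of `cpCurve`. [cite: CohenPazuki2009, §1.2] -/
theorem cpCurve_baseChange (a b : R) (A : Type v) [CommRing A] [Algebra R A] :
    (cpCurve a b).baseChange A = cpCurve (algebraMap R A a) (algebraMap R A b) :=
  map_cpCurve _ a b

/-- The equation of `cpCurve a b`: `y² = x³ − 3(ax + b)²`. [cite: CohenPazuki2009, §1.2] -/
theorem cpCurve_equation_iff (a b x y : R) :
    (cpCurve a b).toAffine.Equation x y ↔ y ^ 2 = x ^ 3 - 3 * (a * x + b) ^ 2 := by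
  rw [Affine.equation_iff]
  simp only [cpCurve]
  constructor <;> intro h <;> linear_combination h

/-- **`threeTorsionModel (aθ) (bθ) = cpCurve a b` when `θ² = −3`**: over a ring containing `√−3` the
curve is the tree's three-torsion model with kernel point `(0, bθ)`. [cite: CohenPazuki2009, §1.2] -/
theorem threeTorsionModel_eq_cpCurve {θ : R} (hθ : θ ^ 2 = -3) (a b : R) :
    threeTorsionModel (a * θ) (b * θ) = cpCurve a b := by
  ext
  · rfl
  · simp only [threeTorsionModel_a₂, cpCurve_a₂]; linear_combination a ^ 2 * hθ
  · rfl
  · simp only [threeTorsionModel_a₄, cpCurve_a₄]; linear_combination (2 * a * b) * hθ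
  · simp only [threeTorsionModel_a₆, cpCurve_a₆]; linear_combination b ^ 2 * hθ

/-- The Vélu quotient of `threeTorsionModel (aθ) (bθ)` is `kernelXThreeCodomain (−3a²) (−6ab) (−3b²) =
[0, −3a², 0, 54ab, 81b² − 144a³b]` when `θ² = −3`. [cite: CohenPazuki2009, Definition 1.3] -/
theorem threeIsogenyCodomain_eq {θ : R} (hθ : θ ^ 2 = -3) (a b : R) :
    threeIsogenyCodomain (a * θ) (b * θ) =
      kernelXThreeCodomain (-3 * a ^ 2) (-6 * a * b) (-3 * b ^ 2) := by
  have hθ4 : θ ^ 4 = 9 := by rw [show θ ^ 4 = (θ ^ 2) ^ 2 by ring, hθ]; norm_num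
  ext
  · rfl
  · simp only [threeIsogenyCodomain_a₂, kernelXThreeCodomain_a₂]; linear_combination a ^ 2 * hθ
  · rfl
  · simp only [threeIsogenyCodomain_a₄, kernelXThreeCodomain_a₄]; linear_combination (-18 * a * b) * hθ
  · simp only [threeIsogenyCodomain_a₆, kernelXThreeCodomain_a₆]
    linear_combination (-27 * b ^ 2) * hθ - 16 * a ^ 3 * b * hθ4

/-- The discriminant: `Δ(cpCurve a b) = −432 b³ (4a³ + 9b)` (Cohen–Pazuki: `16b³D²(4Da³ − 27b)` with
`D = −3`). [cite: CohenPazuki2009, §1.2] -/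
theorem Δ_cpCurve (a b : R) : (cpCurve a b).Δ = -432 * b ^ 3 * (4 * a ^ 3 + 9 * b) := by
  simp only [cpCurve, WeierstrassCurve.Δ, WeierstrassCurve.b₂, WeierstrassCurve.b₄,
    WeierstrassCurve.b₆, WeierstrassCurve.b₈]
  ring

end Model

section FieldModel

variable {F : Type u} [Field F] [CharZero F]

/-- `cpCurve a b` is an elliptic curve iff `b ≠ 0` and `4a³ + 9b ≠ 0`.
[cite: CohenPazuki2009, §1.2] -/
theorem isElliptic_cpCurve_iff (a b : F) :
    (cpCurve a b).IsElliptic ↔ b ≠ 0 ∧ 4 * a ^ 3 + 9 * b ≠ 0 := by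
  rw [WeierstrassCurve.isElliptic_iff, Δ_cpCurve, isUnit_iff_ne_zero]
  constructor
  · intro h
    exact ⟨fun hb => h (by rw [hb]; ring), fun hd => h (by rw [hd]; ring)⟩
  · rintro ⟨hb, hd⟩
    exact mul_ne_zero (mul_ne_zero (by norm_num) (pow_ne_zero 3 hb)) hd

omit [CharZero F] in
/-- **Cohen–Pazuki's isogenous curve, scaled**: for a unit `t` and `t m₂ = 3a`, `t³ s₂ = 4a³ + 9b`,
`⟨t, 4a², 0, 0⟩ • kernelXThreeCodomain (−3a²) (−6ab) (−3b²) = threeTorsionModel m₂ s₂` — the Vélu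
quotient translated by `4a²` is `Y² = X³ + (3aX + 4a³ + 9b)²` (`t = 1`), Cohen–Pazuki's
`Ê : Y² = X³ − 3D(âX + b̂)²` after `X/9`, `Y/27` (`t = 3`). [cite: CohenPazuki2009, Definition 1.3] -/
theorem variableChange_codomain {a b t m₂ s₂ : F} (ht : t ≠ 0) (hm₂ : t * m₂ = 3 * a)
    (hs₂ : t ^ 3 * s₂ = 4 * a ^ 3 + 9 * b) :
    (⟨Units.mk0 t ht, 4 * a ^ 2, 0, 0⟩ : VariableChange F) •
        kernelXThreeCodomain (-3 * a ^ 2) (-6 * a * b) (-3 * b ^ 2) = threeTorsionModel m₂ s₂ := by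
  have hm : m₂ = 3 * a / t := by field_simp; linear_combination hm₂
  have hs : s₂ = (4 * a ^ 3 + 9 * b) / t ^ 3 := by field_simp; linear_combination hs₂
  ext
  · simp [variableChange_a₁]
  · simp only [variableChange_a₂, kernelXThreeCodomain_a₁, kernelXThreeCodomain_a₂,
      Units.val_inv_eq_inv_val, Units.val_mk0, threeTorsionModel_a₂, hm]
    field_simp
    ring
  · simp [variableChange_a₃]
  · simp only [variableChange_a₄, kernelXThreeCodomain_a₁, kernelXThreeCodomain_a₂,
      kernelXThreeCodomain_a₃, kernelXThreeCodomain_a₄, Units.val_inv_eq_inv_val, Units.val_mk0,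
      threeTorsionModel_a₄, hm, hs]
    field_simp
    ring
  · simp only [variableChange_a₆, kernelXThreeCodomain_a₁, kernelXThreeCodomain_a₂,
      kernelXThreeCodomain_a₃, kernelXThreeCodomain_a₄, kernelXThreeCodomain_a₆,
      Units.val_inv_eq_inv_val, Units.val_mk0, threeTorsionModel_a₆, hs]
    field_simp
    ring

end FieldModel

/-! ## The Vélu pair over a field containing `√−3` -/

section Pair

variable {K : Type u} [Field K] [CharZero K] {a b : K}

/-- **Over any `K`-field `L ∋ θ` with `θ² = −3`, the base change of `(cpCurve a b, its Vélu quotient)`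
is the tree's Vélu three-pair with parameters `(aθ, bθ)`** — kernel point `(0, bθ) = (0, b√−3)`.
[cite: CohenPazuki2009, §1.2] -/
theorem isVeluThreePair_of_sq (L : Type v) [Field L] [Algebra K L] {θ : L} (hθ : θ ^ 2 = -3)
    (hb : b ≠ 0) (hd : 4 * a ^ 3 + 9 * b ≠ 0) :
    IsVeluThreePair (algebraMap K L a * θ) (algebraMap K L b * θ) ((cpCurve a b).baseChange L)
      ((kernelXThreeCodomain (-3 * a ^ 2) (-6 * a * b) (-3 * b ^ 2)).baseChange L) := by
  haveI : CharZero L := charZero_of_injective_algebraMap (algebraMap K L).injective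
  have h1 : (cpCurve a b).baseChange L = threeTorsionModel (algebraMap K L a * θ) (algebraMap K L b * θ) := by
    rw [cpCurve_baseChange, threeTorsionModel_eq_cpCurve hθ]
  have h2 : (kernelXThreeCodomain (-3 * a ^ 2) (-6 * a * b) (-3 * b ^ 2)).baseChange L =
      threeIsogenyCodomain (algebraMap K L a * θ) (algebraMap K L b * θ) := by
    rw [threeIsogenyCodomain_eq hθ, WeierstrassCurve.baseChange, kernelXThreeCodomain,
      kernelXThreeCodomain, WeierstrassCurve.map]
    simp only [map_zero, map_neg, map_mul, map_pow, map_ofNat, map_add]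
  rw [h1, h2]
  refine isVeluThreePair_threeTorsionModel ?_
  rw [threeTorsionModel_eq_cpCurve hθ, Δ_cpCurve]
  have hb' : algebraMap K L b ≠ 0 := (map_ne_zero_iff _ (algebraMap K L).injective).mpr hb
  have hd' : 4 * algebraMap K L a ^ 3 + 9 * algebraMap K L b ≠ 0 := by
    have : algebraMap K L (4 * a ^ 3 + 9 * b) ≠ 0 := (map_ne_zero_iff _ (algebraMap K L).injective).mpr hd
    rwa [map_add, map_mul, map_mul, map_pow, map_ofNat, map_ofNat] at this
  exact mul_ne_zero (mul_ne_zero (by norm_num) (pow_ne_zero 3 hb')) hd'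

/-- The pair over `K̄` with `θ = √−3 = MordellDescent.theta K`. [cite: CohenPazuki2009, §1.2] -/
theorem isVeluThreePair_geom (hb : b ≠ 0) (hd : 4 * a ^ 3 + 9 * b ≠ 0) :
    IsVeluThreePair (algebraMap K (AlgebraicClosure K) a * theta K)
      (algebraMap K (AlgebraicClosure K) b * theta K) ((cpCurve a b).baseChange (AlgebraicClosure K))
      ((kernelXThreeCodomain (-3 * a ^ 2) (-6 * a * b) (-3 * b ^ 2)).baseChange (AlgebraicClosure K)) :=
  isVeluThreePair_of_sq _ (theta_sq K) hb hd

/-! ## The `μ₃`-kernel datum `T = (0, b√−3)` -/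

/-- **The kernel point `T = (0, b√−3) ∈ E(K̄)`** of the `3`-isogeny of `cpCurve a b`
(Cohen–Pazuki's `T = (0, b√D)`). [cite: CohenPazuki2009, §1.2] -/
def torsT (hb : b ≠ 0) (hd : 4 * a ^ 3 + 9 * b ≠ 0) : geomPoints (cpCurve a b) :=
  (isVeluThreePair_geom hb hd).T

/-- `T = (0, b√−3)` in coordinates. [cite: CohenPazuki2009, §1.2] -/
theorem torsT_eq (hb : b ≠ 0) (hd : 4 * a ^ 3 + 9 * b ≠ 0) :
    torsT hb hd = Affine.Point.some 0 (algebraMap K (AlgebraicClosure K) b * theta K)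
      (isVeluThreePair_geom hb hd).nonsingular_T :=
  rfl

/-- **`⟨T⟩ ≅ μ₃` as a Galois module**: `σ T = T` if `σ √−3 = √−3` and `σ T = −T` otherwise.
[cite: CohenPazuki2009, §1.2] -/
theorem smul_torsT (hb : b ≠ 0) (hd : 4 * a ^ 3 + 9 * b ≠ 0) (σ : Field.absoluteGaloisGroup K) :
    σ • torsT hb hd = if galAut σ (theta K) = theta K then torsT hb hd else -torsT hb hd := by
  have hV := isVeluThreePair_geom hb hd
  rw [torsT_eq, smul_geomPoints_some σ _ (nonsingular_galAut σ hV.nonsingular_T)]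
  split_ifs with h
  · exact point_some_ext (map_zero _) (by rw [map_mul, AlgEquiv.commutes, h])
  · have e : -torsT hb hd = Affine.Point.some 0 (-(algebraMap K (AlgebraicClosure K) b * theta K))
        hV.nonsingular_negT := hV.neg_T
    refine (point_some_ext (map_zero _) ?_).trans e.symm
    rw [map_mul, AlgEquiv.commutes, (galAut_theta σ).resolve_left h, mul_neg]

/-- **The `μ₃`-kernel datum of `cpCurve a b`**: `T = (0, b√−3)`, `T + T = −T`, `σT = ε(σ)T`. Through
`MuThreeTorsorClass` this gives the torsor classes `[C_u] = (kernelDatum hb hd).torsorClass hu ∈ H¹(K, E)`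
of Cohen–Pazuki's `μ₃`-descent. [cite: CohenPazuki2009, §1.2 and Proposition 1.4 (1)] -/
def kernelDatum (hb : b ≠ 0) (hd : 4 * a ^ 3 + 9 * b ≠ 0) : MuThreeKernel (cpCurve a b) where
  T := torsT hb hd
  T_ne_zero := (isVeluThreePair_geom hb hd).T_ne_zero
  T_add_T := (isVeluThreePair_geom hb hd).T_add_T
  smul_T := smul_torsT hb hd

/-- The datum's point is `torsT`. [cite: CohenPazuki2009, §1.2] -/
@[simp] theorem kernelDatum_T (hb : b ≠ 0) (hd : 4 * a ^ 3 + 9 * b ≠ 0) :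
    (kernelDatum hb hd).T = torsT hb hd := rfl

end Pair

/-! ## Local transport: the pair over `Ē` and the restricted cocycle -/

section Local

variable {K : Type u} [Field K] [CharZero K] {a b : K}
variable {E : Type u} [Field E] [Algebra K E]

/-- **The local Vélu pair**: `(cpCurve a b, its quotient)` over `Ē` with parameters
`(a ι(√−3), b ι(√−3))`, `ι = closureEmb : K̄ → Ē`. [cite: CohenPazuki2009, §1.2] -/
theorem isVeluThreePair_local (hb : b ≠ 0) (hd : 4 * a ^ 3 + 9 * b ≠ 0) :
    IsVeluThreePair (cE E a * thetaE K E) (cE E b * thetaE K E)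
      ((cpCurve a b).baseChange (AlgebraicClosure E))
      ((kernelXThreeCodomain (-3 * a ^ 2) (-6 * a * b) (-3 * b ^ 2)).baseChange (AlgebraicClosure E)) :=
  isVeluThreePair_of_sq _ thetaE_sq hb hd

/-- **The image of `T` in `E(Ē)` is the local kernel point `(0, b ι(√−3))`.** [cite: CohenPazuki2009, §1.2] -/
theorem pointsMap_torsT (hb : b ≠ 0) (hd : 4 * a ^ 3 + 9 * b ≠ 0) :
    pointsMap (cpCurve a b) E (torsT hb hd) = (isVeluThreePair_local (E := E) hb hd).T := by
  have hV := isVeluThreePair_local (E := E) hb hd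
  have hy : iotaE E (algebraMap K (AlgebraicClosure K) b * theta K) = cE E b * thetaE K E := by
    rw [map_mul, ← iotaE_cbar]; rfl
  have h' : ((cpCurve a b).baseChange (AlgebraicClosure E)).toAffine.Nonsingular
      (iotaE E (0 : AlgebraicClosure K)) (iotaE E (algebraMap K (AlgebraicClosure K) b * theta K)) := by
    rw [map_zero, hy]; exact hV.nonsingular_T
  rw [torsT_eq, pointsMap_some _ h']
  exact point_some_ext (map_zero _) hy

/-- `pointsMap (k T) = k T_E`. [cite: CohenPazuki2009, §1.2] -/
theorem pointsMap_nsmul_torsT (hb : b ≠ 0) (hd : 4 * a ^ 3 + 9 * b ≠ 0) (k : ℕ) :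
    pointsMap (cpCurve a b) E (k • torsT hb hd) = k • (isVeluThreePair_local (E := E) hb hd).T := by
  rw [map_nsmul, pointsMap_torsT]
  rfl

/-- `pointsMap (chiT k) = k.val • T_E`. [cite: CohenPazuki2009, §1.2] -/
theorem pointsMap_chiT (hb : b ≠ 0) (hd : 4 * a ^ 3 + 9 * b ≠ 0) (k : ZMod 3) :
    pointsMap (cpCurve a b) E ((kernelDatum hb hd).chiT k) =
      k.val • (isVeluThreePair_local (E := E) hb hd).T := by
  rw [MuThreeKernel.chiT_eq_val_nsmul, kernelDatum_T, pointsMap_nsmul_torsT]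

/-- **The restricted cocycle**: its value at `τ ∈ Γ_E`, pushed to `E(Ē)`, is `n T_E` with
`n = kummerExp u (τ|_K̄)`. [cite: CohenPazuki2009, Proposition 1.4] -/
theorem pointsMap_torsorCocycle (hb : b ≠ 0) (hd : 4 * a ^ 3 + 9 * b ≠ 0) {u : K} (hu : u ≠ 0) (τ : Field.absoluteGaloisGroup E) :
    pointsMap (cpCurve a b) E (((kernelDatum hb hd).torsorCocycle hu).1 (resGal (K := K) E τ)) =
      (kummerExp u (resGal (K := K) E τ)).val • (isVeluThreePair_local (E := E) hb hd).T := by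
  rw [MuThreeKernel.torsorCocycle_apply, MuThreeKernel.torsorFun, pointsMap_chiT]

/-- `τ (jT_E) − jT_E = ((ε(τ) − 1) j) T_E`, through `pointsMap`. [cite: CohenPazuki2009, Proposition 1.4] -/
theorem smul_pointsMap_chiT_sub (hb : b ≠ 0) (hd : 4 * a ^ 3 + 9 * b ≠ 0) (τ : Field.absoluteGaloisGroup E) (j : ZMod 3) :
    τ • pointsMap (cpCurve a b) E ((kernelDatum hb hd).chiT j) -
        pointsMap (cpCurve a b) E ((kernelDatum hb hd).chiT j) =
      pointsMap (cpCurve a b) E ((kernelDatum hb hd).chiT ((eps (resGal (K := K) E τ) - 1) * j)) := by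
  rw [MuThreeKernel.chiT_eps_sub_one_mul, map_sub, pointsMap_smul]

end Local

end CPMuDescent

end Literature.NumberTheory.EllipticCurves

end
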